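import Summits.KontsevichZagierPeriods.KontsevichZagierPeriods.Theorems.SoloInformedToricSector
import Summits.KontsevichZagierPeriods.KontsevichZagierPeriods.Theorems.SoloInformedAlgGerm
import HarnessLib

/-!
# Toric charts for denominators with real algebraic coefficients

Solo programme `solo-KontsevichZagierPeriods-informed`, session s107: the re-base of the
DEN-calculus of the cube crux on a coefficient field `K` of real algebraic numbers
(`SoloInformedAlgGerm`: `hK : ∀ c, IsAlgebraic ℚ (algebraMap K ℝ c)`), step 2 — the one-chart
presentation lemma.

* `soloInformedChartQuotK A Q m` — the chart quotient `Q_A = ∑_a coeff_a(Q) X^{Aᵀa − m}` of a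
  polynomial `Q` with coefficients in any commutative semiring, and the factorisation
  `Q(μ_A v) = v^m · Q_A(v)` on the monomial chart `μ_A(v)ᵢ = ∏ⱼ vⱼ^{A i j}`
  (`soloInformed_aevalK_monomialMap_eq`);
* `soloInformed_presentable_toricChartK_of_ne` — for `Q ∈ K[x]`, an exponent matrix `A` with
  `det A ≠ 0`, `m ≤ Aᵀa` on `supp Q` and `Q_A ≠ 0` on the closed cube, every `IntegralRep` on the
  chart image `μ_A((0,1)ⁿ)` with integrand `y^p/Q(y)` is presentable: the pulled-back form is the
  real part of the `K`-rational cube germ `|det A| · v^{Aᵀp + Aᵀ𝟙 − m − 𝟙} / Q_A(v)`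
  (`soloInformedRationalGermK`), the exponent being non-negative by integrability
  (`soloInformed_le_of_integrableOn_monomialRatio`).

For `K = ℚ` this is `soloInformed_presentable_toricChart_of_ne`; the proof is the same, with the
integer `|det A|` entering the germ as a natural-number constant of `K`.

References: A. G. Kouchnirenko, Invent. Math. 32 (1976) §1; J. Ayoub, EMS Newsl. 91 (2014), §2.2;
M. Kontsevich, D. Zagier, *Periods* (2001), §1.1–1.2; W. Fulton, *Introduction to Toric Varieties*
(1993), §2.6.
-/

noncomputable section

open scoped BigOperators
open MeasureTheory Set
open Literature.NumberTheory.Transcendental Literature.NumberTheory.Transcendental.KZ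
open Literature.ModelTheory.ExponentialFields (IsSemialgebraic)
open Literature.AlgebraicGeometry.Resolution

namespace Summit.KontsevichZagierPeriods.KontsevichZagierPeriods.Theorems

variable {n : ℕ}

/-! ### The chart quotient over a general coefficient semiring -/

section CoeffRing

variable {k : Type*} [CommSemiring k]

/-- `Q(y) = ∑_{a ∈ supp Q} coeff_a(Q) · yᵃ` for a polynomial with coefficients in `k`, evaluated in
a `k`-algebra. [this work] -/
theorem soloInformed_aevalK_eq_sum_support {R : Type*} [CommSemiring R] [Algebra k R]
    (Q : MvPolynomial (Fin n) k) (y : Fin n → R) :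
    MvPolynomial.aeval y Q =
      ∑ a ∈ Q.support, algebraMap k R (MvPolynomial.coeff a Q) * ∏ i, y i ^ a i := by
  conv_lhs => rw [Q.as_sum]
  rw [map_sum]
  exact Finset.sum_congr rfl fun a _ => by
    rw [MvPolynomial.aeval_monomial, Finsupp.prod_fintype _ _ fun i => pow_zero _]

/-- The **chart quotient** `Q_A := ∑_{a ∈ supp Q} coeff_a(Q) · X^{Aᵀ a − m}` of a polynomial with
coefficients in `k`: for `m` the least pulled-back exponent, `Q(μ_A v) = v^m · Q_A(v)`.
[this work] -/
def soloInformedChartQuotK (A : Matrix (Fin n) (Fin n) ℕ) (Q : MvPolynomial (Fin n) k)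
    (m : Fin n → ℕ) : MvPolynomial (Fin n) k :=
  ∑ a ∈ Q.support, MvPolynomial.monomial
    (Finsupp.equivFunOnFinite.symm fun j => (∑ i, A i j * a i) - m j) (MvPolynomial.coeff a Q)

/-- Evaluation of the chart quotient. [this work] -/
theorem soloInformed_aeval_chartQuotK {R : Type*} [CommSemiring R] [Algebra k R]
    (A : Matrix (Fin n) (Fin n) ℕ) (Q : MvPolynomial (Fin n) k) (m : Fin n → ℕ) (x : Fin n → R) :
    MvPolynomial.aeval x (soloInformedChartQuotK A Q m) =
      ∑ a ∈ Q.support, algebraMap k R (MvPolynomial.coeff a Q) *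
        ∏ j, x j ^ ((∑ i, A i j * a i) - m j) := by
  unfold soloInformedChartQuotK
  rw [map_sum]
  refine Finset.sum_congr rfl fun a _ => ?_
  rw [MvPolynomial.aeval_monomial, Finsupp.prod_fintype _ _ fun i => pow_zero _]
  simp only [Finsupp.coe_equivFunOnFinite_symm]

end CoeffRing

/-! ### Factorisation on a chart -/

/-- **Factorisation on a chart**: if `m ≤ Aᵀ a` for every `a ∈ supp Q` then
`Q(μ_A v) = v^m · Q_A(v)` (real points, coefficients in any `ℝ`-algebra-of-scalars `k`).
[this work] -/
theorem soloInformed_aevalK_monomialMap_eq {k : Type*} [CommSemiring k] [Algebra k ℝ]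
    (A : Matrix (Fin n) (Fin n) ℕ) (Q : MvPolynomial (Fin n) k) (m : Fin n → ℕ)
    (hm : ∀ a ∈ Q.support, ∀ j, m j ≤ ∑ i, A i j * a i) (v : Fin n → ℝ) :
    MvPolynomial.aeval (fun i => ∏ j, v j ^ A i j) Q =
      (∏ j, v j ^ m j) * MvPolynomial.aeval v (soloInformedChartQuotK A Q m) := by
  rw [soloInformed_aevalK_eq_sum_support, soloInformed_aeval_chartQuotK, Finset.mul_sum]
  refine Finset.sum_congr rfl fun a ha => ?_
  have h1 : (∏ i, (∏ j, v j ^ A i j) ^ a i) = ∏ j, v j ^ (∑ i, A i j * a i) :=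
    prod_pow_monomialMap A (fun i => a i) (fun i => rfl)
  have h2 : (∏ j, v j ^ (∑ i, A i j * a i)) =
      (∏ j, v j ^ m j) * ∏ j, v j ^ ((∑ i, A i j * a i) - m j) :=
    prod_pow_eq_mul_of_le v (p := m) (q := fun j => ∑ i, A i j * a i) fun j => hm a ha j
  rw [h1, h2]
  ring

/-- `|det A|` as a natural number: `|det A| = natAbs (det A)` computed over `ℤ`, cast to `ℝ`.
[this work] -/
theorem soloInformed_natAbs_det_map (A : Matrix (Fin n) (Fin n) ℕ) :
    (((A.map (fun t : ℕ => (t : ℤ))).det.natAbs : ℕ) : ℝ) =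
      |(A.map (fun t : ℕ => (t : ℝ))).det| := by
  rw [Nat.cast_natAbs, Int.cast_abs]
  congr 1
  rw [show (((A.map (fun t : ℕ => (t : ℤ))).det : ℤ) : ℝ) =
      Int.castRingHom ℝ (A.map (fun t : ℕ => (t : ℤ))).det from rfl,
    RingHom.map_det, RingHom.mapMatrix_apply, Matrix.map_map]
  congr 1

/-! ### One toric chart with coefficients in `K` -/

variable {K : Type*} [Field K] [Algebra K ℝ]

/-- **Presentation of one toric chart piece, coefficients in a field `K` of real algebraic
numbers.**  Let `A` be an exponent matrix with `det A ≠ 0`, `Q ∈ K[x]` and `m ≤ Aᵀ a` for all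
`a ∈ supp Q` such that the chart quotient `Q_A` has no zero on the closed cube `[0,1]ⁿ`, and `R` an
`IntegralRep` on the chart image `μ_A((0,1)ⁿ)` whose integrand there is `y^p / Q(y)`.  Then `of R`
is presentable: the pulled-back form is `Re` of the `K`-rational cube germ
`|det A| · v^{Aᵀp + Aᵀ𝟙 − m − 𝟙} / Q_A(v)`, the exponent being non-negative by integrability.
[this work] -/
theorem soloInformed_presentable_toricChartK_of_ne
    (hK : ∀ c : K, IsAlgebraic ℚ (algebraMap K ℝ c)) (A : Matrix (Fin n) (Fin n) ℕ)
    (hA : (A.map (fun t : ℕ => (t : ℝ))).det ≠ 0) (p : Fin n → ℕ) (Q : MvPolynomial (Fin n) K)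
    (m : Fin n → ℕ) (hmin : ∀ a ∈ Q.support, ∀ j, m j ≤ ∑ i, A i j * a i)
    (hQc : ∀ x : Fin n → ℝ, (∀ j, 0 ≤ x j ∧ x j ≤ 1) →
      (MvPolynomial.aeval x (soloInformedChartQuotK A Q m) : ℝ) ≠ 0)
    (R : IntegralRep n)
    (hdom : R.domain =
      (fun (v : Fin n → ℝ) (i : Fin n) => ∏ j, v j ^ A i j) '' soloInformedOpenCube n)
    (hRi : ∀ v ∈ soloInformedOpenCube n, R.integrand (fun i => ∏ j, v j ^ A i j) =
      (∏ i, (∏ j, v j ^ A i j) ^ p i) /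
        (MvPolynomial.aeval (fun i => ∏ j, v j ^ A i j) Q : ℝ)) :
    of R ∈ soloInformedPresentable := by
  classical
  have hO := soloInformedOpenCube_eq_pi n
  have hQc_ne : ∀ v ∈ soloInformedOpenCube n,
      (MvPolynomial.aeval v (soloInformedChartQuotK A Q m) : ℝ) ≠ 0 :=
    fun v hv => hQc v fun j => ⟨(hv j).1.le, (hv j).2.le⟩
  -- (★) the pulled-back integrand times the Jacobian
  have hkey : ∀ v ∈ soloInformedOpenCube n,
      R.integrand (fun i => ∏ j, v j ^ A i j) * |(soloInformedMonoD A v).det| =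
        |(A.map (fun t : ℕ => (t : ℝ))).det| *
          ((∏ j, v j ^ ((∑ i, A i j * p i) + ∑ i, A i j)) /
            ((∏ j, v j ^ (m j + 1)) *
              (MvPolynomial.aeval v (soloInformedChartQuotK A Q m) : ℝ))) := by
    intro v hv
    have hv0 : ∀ j, 0 < v j := fun j => (hv j).1
    have hnum : (∏ i, (∏ j, v j ^ A i j) ^ p i) = ∏ j, v j ^ (∑ i, A i j * p i) :=
      prod_pow_monomialMap A p (fun i => rfl)
    rw [hRi v hv, soloInformed_abs_det_monoD A hv0, hnum,
      soloInformed_aevalK_monomialMap_eq A Q m hmin v]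
    have hU : (∏ j, v j ^ ((∑ i, A i j * p i) + ∑ i, A i j)) =
        (∏ j, v j ^ (∑ i, A i j * p i)) * ∏ j, v j ^ (∑ i, A i j) := by
      rw [← Finset.prod_mul_distrib]
      exact Finset.prod_congr rfl fun j _ => pow_add _ _ _
    have hW : (∏ j, v j ^ (m j + 1)) = (∏ j, v j ^ m j) * ∏ j, v j := by
      rw [← Finset.prod_mul_distrib]
      exact Finset.prod_congr rfl fun j _ => pow_succ _ _
    rw [hU, hW]
    have h1 : (∏ j, v j) ≠ 0 := Finset.prod_ne_zero_iff.2 fun j _ => (hv0 j).ne'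
    have h2 : (∏ j, v j ^ m j) ≠ 0 :=
      Finset.prod_ne_zero_iff.2 fun j _ => pow_ne_zero _ (hv0 j).ne'
    have h3 : (MvPolynomial.aeval v (soloInformedChartQuotK A Q m) : ℝ) ≠ 0 := hQc_ne v hv
    field_simp
  -- measurability, derivative and injectivity on the open cube
  have hmeasO : MeasurableSet (soloInformedOpenCube n) := by
    rw [hO]; exact MeasurableSet.univ_pi fun _ => measurableSet_Ioo
  have hderiv : ∀ x ∈ soloInformedOpenCube n, HasFDerivWithinAt
      (fun (v : Fin n → ℝ) (i : Fin n) => ∏ j, v j ^ A i j) (soloInformedMonoD A x)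
      (soloInformedOpenCube n) x :=
    fun x _ => soloInformed_hasFDerivWithinAt_monomialMap A _ x
  have hinj : InjOn (fun (v : Fin n → ℝ) (i : Fin n) => ∏ j, v j ^ A i j)
      (soloInformedOpenCube n) := by
    rw [hO]; exact injOn_monomialMap_pi_Ioo hA
  -- integrability of the pulled-back form (change of variables) ...
  have hint1 : IntegrableOn (fun v => |(soloInformedMonoD A v).det| •
      R.integrand (fun i => ∏ j, v j ^ A i j)) (soloInformedOpenCube n) := by
    have h := R.integrableOn
    rw [hdom, integrableOn_image_iff_integrableOn_abs_det_fderiv_smul volume hmeasO hderiv hinj]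
      at h
    exact h
  -- continuity of `v ↦ Q_A(v)` and a bound on the closed cube (compactness)
  have hcont : Continuous fun v : Fin n → ℝ =>
      (MvPolynomial.aeval v (soloInformedChartQuotK A Q m) : ℝ) :=
    soloInformed_continuous_aevalK _
  obtain ⟨C, hC⟩ : ∃ C : ℝ, ∀ x ∈ soloInformedCube n,
      ‖(MvPolynomial.aeval x (soloInformedChartQuotK A Q m) : ℝ)‖ ≤ C := by
    have hK : IsCompact (soloInformedCube n) := by
      rw [soloInformedCube_eq_Icc]; exact isCompact_Icc
    exact hK.exists_bound_of_continuousOn hcont.continuousOn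
  -- ... hence of the monomial ratio `v^U / v^{m+1}` (the factor `Q_A/|det A|` is bounded)
  have hratio : IntegrableOn (fun v : Fin n → ℝ =>
      (∏ j, v j ^ ((∑ i, A i j * p i) + ∑ i, A i j)) / ∏ j, v j ^ (m j + 1))
      (Set.pi univ fun _ : Fin n => Ioo (0 : ℝ) 1) := by
    rw [← hO]
    have hb : IntegrableOn (fun v => ((MvPolynomial.aeval v (soloInformedChartQuotK A Q m) : ℝ) /
        |(A.map (fun t : ℕ => (t : ℝ))).det|) * (|(soloInformedMonoD A v).det| •
        R.integrand (fun i => ∏ j, v j ^ A i j))) (soloInformedOpenCube n) := by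
      refine Integrable.bdd_mul hint1 ((hcont.div_const _).aestronglyMeasurable)
        (c := C / |(A.map (fun t : ℕ => (t : ℝ))).det|)
        (ae_restrict_of_forall_mem hmeasO fun v hv => ?_)
      rw [Real.norm_eq_abs, abs_div, abs_abs]
      exact div_le_div_of_nonneg_right
        (by simpa [Real.norm_eq_abs] using hC v (soloInformedOpenCube_subset_cube n hv))
        (abs_nonneg _)
    refine hb.congr_fun (fun v hv => ?_) hmeasO
    have hv0 : ∀ j, 0 < v j := fun j => (hv j).1
    dsimp only
    rw [smul_eq_mul, mul_comm |(soloInformedMonoD A v).det|, hkey v hv]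
    have h1 : (∏ j, v j ^ (m j + 1)) ≠ 0 :=
      Finset.prod_ne_zero_iff.2 fun j _ => pow_ne_zero _ (hv0 j).ne'
    have h3 : (MvPolynomial.aeval v (soloInformedChartQuotK A Q m) : ℝ) ≠ 0 := hQc_ne v hv
    have h4 : |(A.map (fun t : ℕ => (t : ℝ))).det| ≠ 0 := abs_ne_zero.2 hA
    field_simp
  -- the exponent `U − m − 1` is non-negative
  have hle : ∀ j, m j + 1 ≤ (∑ i, A i j * p i) + ∑ i, A i j :=
    soloInformed_le_of_integrableOn_monomialRatio _ _ hratio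
  obtain ⟨e, he⟩ : ∃ e : Fin n → ℕ, ∀ j, (∑ i, A i j * p i) + ∑ i, A i j = (m j + 1) + e j :=
    ⟨fun j => ((∑ i, A i j * p i) + ∑ i, A i j) - (m j + 1),
      fun j => (Nat.add_sub_cancel' (hle j)).symm⟩
  -- the germ `|det A| · X^e / Q_A`, with `|det A| = natAbs (det A) ∈ ℕ ⊆ K`
  have hQc' : ∀ x ∈ soloInformedCube n,
      (MvPolynomial.aeval x (soloInformedChartQuotK A Q m) : ℝ) ≠ 0 :=
    fun x hx => hQc x (soloInformed_mem_cube_iff.1 hx)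
  set N : ℕ := (A.map (fun t : ℕ => (t : ℤ))).det.natAbs with hN
  refine soloInformed_presentable_of_nashImage R
    (fun (v : Fin n → ℝ) (i : Fin n) => ∏ j, v j ^ A i j) (soloInformedMonoD A)
    (soloInformedRationalGermK hK (MvPolynomial.C (N : K) * ∏ j, MvPolynomial.X j ^ e j)
      (soloInformedChartQuotK A Q m) hQc')
    (isSemialgebraicMapOn_monomialMap A (isSemialgebraic_soloInformedOpenCube n))
    hderiv hinj hdom fun v hv => ?_
  -- the integrand identity on the open cube
  have hv0 : ∀ j, 0 < v j := fun j => (hv j).1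
  rw [soloInformedRationalGermK_g_re, hkey v hv]
  simp only [map_mul, map_prod, map_pow, MvPolynomial.aeval_X, map_natCast]
  rw [hN, soloInformed_natAbs_det_map]
  have hU : (∏ j, v j ^ ((∑ i, A i j * p i) + ∑ i, A i j)) =
      (∏ j, v j ^ (m j + 1)) * ∏ j, v j ^ e j := by
    rw [← Finset.prod_mul_distrib]
    exact Finset.prod_congr rfl fun j _ => by rw [he j, pow_add]
  rw [hU]
  have h1 : (∏ j, v j ^ (m j + 1)) ≠ 0 :=
    Finset.prod_ne_zero_iff.2 fun j _ => pow_ne_zero _ (hv0 j).ne'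
  have h3 : (MvPolynomial.aeval v (soloInformedChartQuotK A Q m) : ℝ) ≠ 0 := hQc_ne v hv
  field_simp

end Summit.KontsevichZagierPeriods.KontsevichZagierPeriods.Theorems
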